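import Summits.RiemannHypothesis.RiemannHypothesis.Theorems.GroundBartaEvenWinsBeyondArchDeflationWindowLoc2
import Literature.Analysis.ValidatedNumerics.TaylorModelL2Split
import Literature.NumberTheory.LFunctions.WeilDeflationPenaltyPolyEval
import HarnessLib

/-!
# RiemannHypothesis / GroundBarta — rung 4 (`EvenWinsBeyondArch`, stmt-RiemannHypothesis-18807 / 18085):
# the endpoint cell — kernel-computable sup and leak bounds for the trial polynomials

Helper file (`--supports stmt-RiemannHypothesis-18085`), RH-free.  Prover B (gen 6 of unit `sr-gb-rung-b`).

The endpoint bridge `dt_weil{Odd,Even}GroundEnergy_ge_of_deflCert_wxa` and the thin-shell Gram correction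
`dt_shell_wgram_bounds` need three FINITE numbers per trial vector, all about explicit polynomials with rational
coefficients: a sup bound `G_i ≥ sup_{[-c',c']}|g_i|` of the A/R-layer profile `g_i(x) = P̃_i(x/c')`, the format mismatch
`∫_{[-c',c']}(p_i − g_i)²` between the certificate's penalty `p_i = maskPoly R_i n a₀` and `g_i`, and the certificate-shell
leak `∫_{[-a₀,a₀]∖[-c',c']} p_i²`.  This file reduces them to `decide`-able rational inequalities:

* `dt_supBoundQ P N` — `max_j absBoundQ (shift P m_j) (1/N)` over `N` sub-intervals of `[-1,1]`, and `dt_abs_eval_le_supBoundQ`: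
  `|P(y)| ≤ dt_supBoundQ P N` for `|y| ≤ 1` (localised Taylor forms beat the huge alternating coefficients of the Ritz polynomials);
* `dt_leak_mismatch_le` — `∫_{[-c',c']}(maskPoly R n a₀ − P̃(·/c'))² ≤ 2c'·ε²` whenever
  `absBoundQ (rescale ĉ a₀ − rescale P̃ c') c' ≤ ε`;
* `dt_leak_shell_le` — `∫_{[-a₀,a₀]∖[-c',c']} (maskPoly R n a₀)² ≤ 2(a₀ − c')·B²` whenever the localised bound of the trimmed
  penalty polynomial on `[c'/a₀, 1]` is `≤ B` (parity reduces `[-a₀,-c')` to `(c', a₀]`).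
-/

set_option linter.dupNamespace false

noncomputable section

open MeasureTheory Set Filter
open scoped Topology BigOperators

namespace Summit.RiemannHypothesis.RiemannHypothesis.Theorems.EvenWinsBeyondArch

open Literature.NumberTheory.LFunctions
open Literature.Analysis.ValidatedNumerics Literature.Analysis.ValidatedNumerics.PolyMP
  Literature.Analysis.ValidatedNumerics.ExpPoly

/-! ## A sup bound on `[-1, 1]` by localised Taylor forms -/

/-- The sub-interval sup bound: `max_{j<N} absBoundQ (shift P m_j) (1/N)`, `m_j = (2j+1)/N − 1` (centres of `N` intervals of
length `2/N` covering `[-1, 1]`). [folklore] -/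
def dt_supBoundQ (P : Poly) (N : ℕ) : ℚ :=
  ((List.range N).map fun j : ℕ ↦ absBoundQ (Poly.shift P ((2 * (j : ℚ) + 1) / N - 1)) (1 / N)).foldr max 0

/-- Members of a list are below its `foldr max 0`. [folklore] -/
theorem dt_le_foldr_max : ∀ (l : List ℚ) {x : ℚ}, x ∈ l → x ≤ l.foldr max 0
  | [], x, hx => by simp at hx
  | a :: l, x, hx => by
      rw [List.foldr_cons]
      rcases List.mem_cons.1 hx with rfl | h
      · exact le_max_left _ _
      · exact (dt_le_foldr_max l h).trans (le_max_right _ _)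

/-- `0 ≤ foldr max 0`. [folklore] -/
theorem dt_foldr_max_nonneg : ∀ (l : List ℚ), 0 ≤ l.foldr max 0
  | [] => le_rfl
  | a :: l => by rw [List.foldr_cons]; exact (dt_foldr_max_nonneg l).trans (le_max_right _ _)

/-- **Sup bound on `[-1,1]`**: `|P(y)| ≤ dt_supBoundQ P N` for `|y| ≤ 1`, `N ≥ 1`. [folklore] -/
theorem dt_abs_eval_le_supBoundQ (P : Poly) {N : ℕ} (hN : 0 < N) {y : ℝ} (hy : |y| ≤ 1) :
    |Poly.eval P y| ≤ ((dt_supBoundQ P N : ℚ) : ℝ) := by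
  have hNR : (0 : ℝ) < N := by exact_mod_cast hN
  obtain ⟨hy1, hy2⟩ := abs_le.1 hy
  -- the sub-interval index
  set t : ℝ := (y + 1) / 2 * N with ht
  have ht0 : 0 ≤ t := by rw [ht]; exact mul_nonneg (by linarith) hNR.le
  have htN : t ≤ N := by rw [ht]; nlinarith
  set j : ℕ := min (N - 1) ⌊t⌋₊ with hj
  have hjN : j < N := lt_of_le_of_lt (min_le_left _ _) (Nat.sub_lt hN one_pos)
  have hjle : (j : ℝ) ≤ t := by
    have h1 : (j : ℝ) ≤ (⌊t⌋₊ : ℝ) := by exact_mod_cast min_le_right (N - 1) ⌊t⌋₊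
    exact h1.trans (Nat.floor_le ht0)
  have hjge : t ≤ (j : ℝ) + 1 := by
    by_cases hcase : ⌊t⌋₊ ≤ N - 1
    · have : j = ⌊t⌋₊ := by rw [hj, min_eq_right hcase]
      rw [this]; exact (Nat.lt_floor_add_one t).le
    · have hj' : j = N - 1 := by rw [hj, min_eq_left (not_le.1 hcase).le]
      rw [hj']
      have : ((N - 1 : ℕ) : ℝ) + 1 = N := by
        rw [Nat.cast_sub (Nat.one_le_iff_ne_zero.2 hN.ne')]; push_cast; ring
      rw [this]; exact htN
  -- the centre and the localised bound
  set mQ : ℚ := (2 * (j : ℚ) + 1) / N - 1 with hmQ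
  have hym : |(mQ : ℝ) - y| ≤ ((1 / (N : ℚ) : ℚ) : ℝ) := by
    have e : (mQ : ℝ) - y = (2 * (j : ℝ) + 1 - 2 * t) / N := by
      rw [hmQ, ht]; push_cast; field_simp; ring
    rw [e, abs_div, abs_of_pos hNR]
    push_cast
    rw [div_le_div_iff_of_pos_right hNR, abs_le]
    constructor <;> linarith
  have hloc : |Poly.eval P y| ≤ ((absBoundQ (Poly.shift P mQ) (1 / N) : ℚ) : ℝ) := by
    have e : Poly.eval P y = Poly.eval (Poly.shift P mQ) ((mQ : ℝ) - y) := by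
      rw [Poly.eval_shift]; congr 1; ring
    rw [e]
    exact abs_eval_le_absBoundQ _ hym
  refine hloc.trans ?_
  rw [dt_supBoundQ]
  have hmem : absBoundQ (Poly.shift P mQ) (1 / N) ∈
      (List.range N).map fun j : ℕ ↦ absBoundQ (Poly.shift P ((2 * (j : ℚ) + 1) / N - 1)) (1 / N) :=
    List.mem_map_of_mem (f := fun j : ℕ ↦ absBoundQ (Poly.shift P ((2 * (j : ℚ) + 1) / N - 1)) (1 / N))
      (List.mem_range.2 hjN)
  exact_mod_cast dt_le_foldr_max _ hmem

/-- **Sup bound of a scaled profile**: `|P(x/c)| ≤ dt_supBoundQ P N` for `|x| ≤ c`, `c > 0`. [folklore] -/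
theorem dt_abs_eval_div_le_supBoundQ (P : Poly) {N : ℕ} (hN : 0 < N) {c : ℚ} (hc : 0 < c) {x : ℝ}
    (hx : x ∈ Icc (-(c : ℝ)) c) : |Poly.eval P (x / c)| ≤ ((dt_supBoundQ P N : ℚ) : ℝ) := by
  refine dt_abs_eval_le_supBoundQ P hN ?_
  have hcR : (0 : ℝ) < c := by exact_mod_cast hc
  rw [abs_div, abs_of_pos hcR, div_le_one hcR, abs_le]
  exact ⟨hx.1, hx.2⟩

/-! ## The format mismatch `∫_{[-c',c']}(p − g)²` -/

/-- **The mismatch leak**: if the penalty `maskPoly R n a₀ = P(·/a₀)` (trimmed data `P`) and the profile `P̃(·/c')` differ, as a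
polynomial in `x`, by `D = rescale P a₀ − rescale P̃ c'` with `absBoundQ D c' ≤ ε`, then
`∫_{[-c',c']}(maskPoly R n a₀ x − P̃(x/c'))² dx ≤ 2c'·ε²`. [folklore] -/
theorem dt_leak_mismatch_le (r : ℚ × ℕ × List ℚ) (n : ℕ) {a₀ c' : ℚ} (hc' : 0 < c') (P Pt : Poly) {m : ℕ}
    (htrim : (List.range n).map (maskV r) = P ++ List.replicate m 0) {ε : ℚ}
    (hε : absBoundQ (Poly.add (dt_rescaleQ P a₀) (Poly.smul (-1) (dt_rescaleQ Pt c'))) c' ≤ ε) :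
    ∫ x in Icc (-(c' : ℝ)) c', (maskPoly r n a₀ x - Poly.eval Pt (x / c')) ^ 2 ≤ 2 * (c' : ℝ) * (ε : ℝ) ^ 2 := by
  have hc'R : (0 : ℝ) < c' := by exact_mod_cast hc'
  set D : Poly := Poly.add (dt_rescaleQ P a₀) (Poly.smul (-1) (dt_rescaleQ Pt c')) with hD
  have hpt : ∀ x : ℝ, maskPoly r n a₀ x - Poly.eval Pt (x / c') = Poly.eval D x := by
    intro x
    rw [maskPoly_eq_poly_eval_of_trim r n htrim, hD, Poly.eval_add, Poly.eval_smul, dt_eval_rescaleQ, dt_eval_rescaleQ]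
    push_cast; ring
  have hε0 : (0 : ℝ) ≤ ε := by
    have h0 : (0 : ℚ) ≤ absBoundQ D c' := by
      have := abs_eval_le_absBoundQ D (y := 0) (h := c') (by rw [abs_zero]; exact_mod_cast hc'.le)
      exact_mod_cast (abs_nonneg _).trans this
    exact_mod_cast h0.trans hε
  have hbd : ∀ x ∈ Icc (-(c' : ℝ)) c', (maskPoly r n a₀ x - Poly.eval Pt (x / c')) ^ 2 ≤ (ε : ℝ) ^ 2 := by
    intro x hx
    rw [hpt x]
    have h1 : |Poly.eval D x| ≤ ((absBoundQ D c' : ℚ) : ℝ) := abs_eval_le_absBoundQ D (abs_le.2 ⟨hx.1, hx.2⟩)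
    have h2 : |Poly.eval D x| ≤ (ε : ℝ) := h1.trans (by exact_mod_cast hε)
    nlinarith [abs_nonneg (Poly.eval D x), sq_abs (Poly.eval D x)]
  have hvol : volume (Icc (-(c' : ℝ)) c') = ENNReal.ofReal (2 * c') := by rw [Real.volume_Icc]; ring_nf
  have hcont : Continuous fun x : ℝ ↦ (maskPoly r n a₀ x - Poly.eval Pt (x / c')) ^ 2 := by
    have : (fun x : ℝ ↦ (maskPoly r n a₀ x - Poly.eval Pt (x / c')) ^ 2) = fun x ↦ (Poly.eval D x) ^ 2 := by
      funext x; rw [hpt x]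
    rw [this]; exact (Poly.continuous_eval D).pow 2
  calc ∫ x in Icc (-(c' : ℝ)) c', (maskPoly r n a₀ x - Poly.eval Pt (x / c')) ^ 2
      ≤ ∫ x in Icc (-(c' : ℝ)) c', (ε : ℝ) ^ 2 :=
        setIntegral_mono_on hcont.continuousOn.integrableOn_Icc
          (integrableOn_const (ne_top_of_le_ne_top ENNReal.ofReal_ne_top hvol.le)) measurableSet_Icc hbd
    _ = 2 * (c' : ℝ) * (ε : ℝ) ^ 2 := by
        rw [setIntegral_const, Measure.real, hvol, ENNReal.toReal_ofReal (by linarith), smul_eq_mul]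

/-! ## The certificate-shell leak `∫_{[-a₀,a₀]∖[-c',c']} p²` -/

/-- **The shell leak**: for a penalty `maskPoly R n a₀ = P(·/a₀)` of parity `σ = ±1` and `0 < c' ≤ a₀`, if the localised bound of
`P` on `[c'/a₀, 1]` is `≤ B` then `∫_{[-a₀,a₀]∖[-c',c']} (maskPoly R n a₀)² ≤ 2(a₀ − c')·B²`. [folklore] -/
theorem dt_leak_shell_le (r : ℚ × ℕ × List ℚ) (n : ℕ) {a₀ c' : ℚ} (hc' : 0 < c') (hca : c' ≤ a₀) (P : Poly) {m : ℕ}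
    (htrim : (List.range n).map (maskV r) = P ++ List.replicate m 0) {σ : ℝ} (hσ : σ = 1 ∨ σ = -1)
    (hpar : ∀ x : ℝ, maskPoly r n a₀ (-x) = σ * maskPoly r n a₀ x) {B : ℚ}
    (hB : absBoundQ (Poly.shift P ((c' / a₀ + 1) / 2)) ((1 - c' / a₀) / 2) ≤ B) :
    ∫ x in Icc (-(a₀ : ℝ)) a₀ \ Icc (-(c' : ℝ)) c', (maskPoly r n a₀ x) ^ 2 ≤ 2 * ((a₀ : ℝ) - c') * (B : ℝ) ^ 2 := by
  have hc'R : (0 : ℝ) < c' := by exact_mod_cast hc'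
  have hcaR : (c' : ℝ) ≤ a₀ := by exact_mod_cast hca
  have ha0 : (0 : ℝ) < a₀ := hc'R.trans_le hcaR
  have ha0q : (0 : ℚ) < a₀ := hc'.trans_le hca
  -- the bound on `(c', a₀]` and, by parity, on `[-a₀, -c')`
  have hpos : ∀ x : ℝ, (c' : ℝ) ≤ x → x ≤ a₀ → |maskPoly r n a₀ x| ≤ (B : ℝ) := by
    intro x h1 h2
    rw [maskPoly_eq_poly_eval_of_trim r n htrim]
    have h := abs_eval_le_absBoundQ_loc P (a := c' / a₀) (b := 1) (ρ := x / a₀)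
      (by push_cast; rw [div_le_div_iff_of_pos_right ha0]; exact h1) (by push_cast; rw [div_le_one ha0]; exact h2)
    exact h.trans (by exact_mod_cast hB)
  have hB0 : (0 : ℝ) ≤ B := (abs_nonneg _).trans (hpos a₀ hcaR le_rfl)
  have hbd : ∀ x ∈ Icc (-(a₀ : ℝ)) a₀ \ Icc (-(c' : ℝ)) c', (maskPoly r n a₀ x) ^ 2 ≤ (B : ℝ) ^ 2 := by
    intro x hx
    obtain ⟨⟨hx1, hx2⟩, hxn⟩ := hx
    have habs : |maskPoly r n a₀ x| ≤ B := by
      rcases le_or_gt 0 x with h0 | h0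
      · have hxc : (c' : ℝ) < x := by
          by_contra hle; exact hxn ⟨by linarith, not_lt.1 hle⟩
        exact hpos x hxc.le hx2
      · have hxc : x < -(c' : ℝ) := by
          by_contra hle; exact hxn ⟨not_lt.1 hle, by linarith⟩
        have e : |maskPoly r n a₀ x| = |maskPoly r n a₀ (-x)| := by
          rw [hpar x, abs_mul]
          rcases hσ with rfl | rfl <;> simp
        rw [e]; exact hpos (-x) (by linarith) (by linarith)
    nlinarith [abs_nonneg (maskPoly r n a₀ x), sq_abs (maskPoly r n a₀ x)]
  have hsub : Icc (-(c' : ℝ)) c' ⊆ Icc (-(a₀ : ℝ)) a₀ := Icc_subset_Icc (by linarith) hcaR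
  have hvol : volume (Icc (-(a₀ : ℝ)) a₀ \ Icc (-(c' : ℝ)) c') = ENNReal.ofReal (2 * (a₀ - c')) := by
    rw [measure_sdiff hsub measurableSet_Icc.nullMeasurableSet (by rw [Real.volume_Icc]; exact ENNReal.ofReal_ne_top),
      Real.volume_Icc, Real.volume_Icc, ← ENNReal.ofReal_sub _ (by linarith)]
    ring_nf
  have hcont : Continuous fun x : ℝ ↦ (maskPoly r n a₀ x) ^ 2 := (contDiff_maskPoly r n a₀ (m := 0)).continuous.pow 2
  calc ∫ x in Icc (-(a₀ : ℝ)) a₀ \ Icc (-(c' : ℝ)) c', (maskPoly r n a₀ x) ^ 2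
      ≤ ∫ x in Icc (-(a₀ : ℝ)) a₀ \ Icc (-(c' : ℝ)) c', (B : ℝ) ^ 2 :=
        setIntegral_mono_on (hcont.continuousOn.integrableOn_Icc.mono_set sdiff_subset)
          (integrableOn_const (ne_top_of_le_ne_top ENNReal.ofReal_ne_top hvol.le))
          (measurableSet_Icc.diff measurableSet_Icc) hbd
    _ = 2 * ((a₀ : ℝ) - c') * (B : ℝ) ^ 2 := by
        rw [setIntegral_const, Measure.real, hvol, ENNReal.toReal_ofReal (by linarith), smul_eq_mul]

end Summit.RiemannHypothesis.RiemannHypothesis.Theorems.EvenWinsBeyondArch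

end
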